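import Summits.QuantumFields.YangMills.Theorems.BalabanUVNodesN15KingModelComplexBlockFormFactor

/-!
# BalabanUVNodes ∕ N15 — THE KING-MODEL RUNG (PART Ϸ-b₁): THE ONE-LINE BLOCK PROPAGATOR ON THE REAL LINE AND ON THE SHIFTED LINES `Im w = ±c` —
# integrability, the UNIFORM line bound `∫|propLine M²(x + ic)|dx ≤ 2π(1 + cosh c)∕(|c|(m² − c²))` (`c² < m² ≤ M²`), and uniform smallness as `|Re w| → ∞` in the strip
# (the three hypotheses of the Paley–Wiener shift, part Ϸ-b₂)
# (Track A, DAG node N15 = NE2; FAN-OUT v1.1 §N15 s3 «KING-MODEL RUNG»; uses part Ϸ-a (`sincSqC`, `propLine`, bounds) and part Ϝ-j's sinc window; count-neutral)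

HONEST FRAMING.  Count-neutral (cell `pub-ymgap`, seat `pub-ymgap-dag-n15-e` g34; `--supports stmt-QuantumFields-27366 --as helper` = K3⁸
`SpineGivenEndpointR13SepCoPHV`).  King's `A = 0`, `g = 0` model ([King1986] C. King, Commun. Math. Phys. **102** (1986) 649–677): elementary estimates for part Ϸ-a's
one-line block propagator `propLine M² w = sincSqC w∕(w² + M²)` (`M² = m² + |p_⊥|² ≥ m²`), which are exactly the hypotheses of the Paley–Wiener shift used in part Ϸ-b₂:
integrability on `Im w = 0` (sinc window) and on `Im w = c` (`c ≠ 0`, `c² < m²`; majorant `2(1+cosh c)∕((x²+c²)(m²−c²))`, whose integral is `2π(1+cosh c)∕(|c|(m²−c²))`,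
UNIFORMLY in `M² ≥ m²`), and `propLine M² w → 0` uniformly as `|Re w| → ∞` in `|Im w| < √m²`.  NOT a node discharge (N15 is booked through n15-a's knit, untouched here);
nothing Bałaban ∕ continuum-Yang–Mills ∕ `ℝ⁴` ∕ OS ∕ Clay; the «mass» is the free field's `m`.  0 `sorry`, 0 def; standard axioms.

WHAT THIS FILE PROVES (kernel).  §1 `continuous_propLine_ofReal`, `norm_propLine_ofReal_le`, ★ `integrable_propLine_ofReal`; §2 `im_sq_lt_of_line`, `continuous_propLine_line`,
★ `norm_propLine_line_le`, ★ `integrable_propLine_line`, ★★ **`integral_norm_propLine_line_le`**; §3 ★ **`propLine_uniformly_small`**.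

HONEST SCOPE.  Elementary real∕complex analysis; folklore; constants not optimised.  N15 untouched; counts unmoved.  Locators (use): [King1986] (4.3) p.670, (4.38) p.675.
-/

noncomputable section

open scoped BigOperators Topology
open Complex Filter MeasureTheory

namespace Summit.QuantumFields.YangMills.BalabanUVNodes.N15KingModelRung.OptimalDecay

/-! ## §1 The one-line block propagator on the real line -/

section RealLine

variable {M2 : ℝ}

/-- `x ↦ propLine M² x` is continuous on `ℝ` (`M² > 0`). [folklore] -/
theorem continuous_propLine_ofReal (hM : 0 < M2) : Continuous fun x : ℝ => propLine M2 (x : ℂ) := by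
  have hden : ∀ x : ℝ, (x : ℂ) ^ 2 + (M2 : ℂ) ≠ 0 := fun x =>
    sq_add_ne_zero_of_im_sq_lt hM (by simp [hM])
  unfold propLine
  exact (continuous_sincSqC.comp continuous_ofReal).div (by fun_prop) hden

/-- On the real line, away from `0`: `|propLine M² x| ≤ (17 + 16π²)·M⁻²·(1 + x²)⁻¹` (part Ϝ-j's sinc window). [folklore] -/
theorem norm_propLine_ofReal_le (hM : 0 < M2) {x : ℝ} (hx : x ≠ 0) :
    ‖propLine M2 (x : ℂ)‖ ≤ (17 + 16 * Real.pi ^ 2) * M2⁻¹ * (1 + x ^ 2)⁻¹ := by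
  rw [norm_propLine_ofReal hM.le hx]
  have hs : Real.sinc (x / 2) ^ 2 ≤ (17 + 16 * Real.pi ^ 2) * (1 + x ^ 2)⁻¹ :=
    sinc_sq_half_window (s := x) (t := x) (by simp; positivity)
  have h2 : Real.sinc (x / 2) ^ 2 / (x ^ 2 + M2) ≤ Real.sinc (x / 2) ^ 2 / M2 :=
    div_le_div_of_nonneg_left (sq_nonneg _) hM (by nlinarith [sq_nonneg x])
  calc Real.sinc (x / 2) ^ 2 / (x ^ 2 + M2) ≤ Real.sinc (x / 2) ^ 2 / M2 := h2
    _ ≤ (17 + 16 * Real.pi ^ 2) * (1 + x ^ 2)⁻¹ / M2 := div_le_div_of_nonneg_right hs hM.le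
    _ = (17 + 16 * Real.pi ^ 2) * M2⁻¹ * (1 + x ^ 2)⁻¹ := by ring

/-- ★ `x ↦ propLine M² x` is integrable on `ℝ`. [folklore] -/
theorem integrable_propLine_ofReal (hM : 0 < M2) : Integrable fun x : ℝ => propLine M2 (x : ℂ) := by
  refine (integrable_inv_one_add_sq.const_mul ((17 + 16 * Real.pi ^ 2) * M2⁻¹)).mono'
    (continuous_propLine_ofReal hM).aestronglyMeasurable ?_
  filter_upwards [compl_mem_ae_iff.mpr (measure_singleton (0 : ℝ))] with x hx
  exact norm_propLine_ofReal_le hM hx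

end RealLine

/-! ## §2 The shifted line `Im w = c` -/

section ShiftedLine

variable {m2 M2 c : ℝ}

/-- On the line `Im w = c` with `c² < m² ≤ M²`: `Im²w < M²`. [folklore] -/
theorem im_sq_lt_of_line (hmM : m2 ≤ M2) (hc : c ^ 2 < m2) (x : ℝ) : ((x : ℂ) + c * I).im ^ 2 < M2 := by
  simp only [add_im, ofReal_im, mul_im, ofReal_re, I_im, mul_one, I_re, mul_zero, add_zero, zero_add]
  linarith

/-- `x ↦ propLine M²(x + ic)` is continuous (`c² < m² ≤ M²`, `M² > 0`). [folklore] -/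
theorem continuous_propLine_line (hM : 0 < M2) (hmM : m2 ≤ M2) (hc : c ^ 2 < m2) :
    Continuous fun x : ℝ => propLine M2 ((x : ℂ) + c * I) := by
  have hden : ∀ x : ℝ, ((x : ℂ) + c * I) ^ 2 + (M2 : ℂ) ≠ 0 := fun x =>
    sq_add_ne_zero_of_im_sq_lt hM (im_sq_lt_of_line hmM hc x)
  unfold propLine
  exact (continuous_sincSqC.comp (by fun_prop)).div (by fun_prop) hden

/-- ★ **THE BOUND ON THE SHIFTED LINE**, uniform in `M² ≥ m²`: `|propLine M²(x + ic)| ≤ 2(1 + cosh c)∕((x² + c²)(m² − c²))` (`c ≠ 0`, `c² < m²`). [folklore] -/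
theorem norm_propLine_line_le (hmM : m2 ≤ M2) (hc0 : c ≠ 0) (hc : c ^ 2 < m2) (x : ℝ) :
    ‖propLine M2 ((x : ℂ) + c * I)‖ ≤ 2 * (1 + Real.cosh c) / ((x ^ 2 + c ^ 2) * (m2 - c ^ 2)) := by
  set w : ℂ := (x : ℂ) + c * I with hw
  have hre : w.re = x := by simp [hw]
  have him : w.im = c := by simp [hw]
  have hw0 : w ≠ 0 := fun h => hc0 (by rw [← him, h, zero_im])
  have hnorm : ‖w‖ ^ 2 = x ^ 2 + c ^ 2 := by rw [hw, Complex.sq_norm, Complex.normSq_add_mul_I]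
  have h1 := norm_propLine_le (M2 := M2) hw0 (by rw [hre, him]; nlinarith [sq_nonneg x])
  rw [hre, him, hnorm] at h1
  refine h1.trans (div_le_div_of_nonneg_left (by positivity [Real.cosh_pos c]) ?_ ?_)
  · have : 0 < x ^ 2 + c ^ 2 := by positivity
    exact mul_pos this (by linarith)
  · exact mul_le_mul_of_nonneg_left (by nlinarith [sq_nonneg x]) (by positivity)

/-- ★ `x ↦ propLine M²(x + ic)` is integrable (majorant `2(1+cosh c)∕(m²−c²)·c⁻²·(1 + (x∕c)²)⁻¹`). [folklore] -/
theorem integrable_propLine_line (hM : 0 < M2) (hmM : m2 ≤ M2) (hc0 : c ≠ 0) (hc : c ^ 2 < m2) :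
    Integrable fun x : ℝ => propLine M2 ((x : ℂ) + c * I) := by
  refine (((integrable_inv_one_add_sq.comp_div hc0).const_mul (2 * (1 + Real.cosh c) / (m2 - c ^ 2) * (c ^ 2)⁻¹))).mono'
    (continuous_propLine_line hM hmM hc).aestronglyMeasurable (Eventually.of_forall fun x => ?_)
  refine (norm_propLine_line_le hmM hc0 hc x).trans (le_of_eq ?_)
  have hc2 : c ^ 2 ≠ 0 := pow_ne_zero 2 hc0
  have hmc : m2 - c ^ 2 ≠ 0 := by linarith
  field_simp
  ring

/-- ★★ **THE LINE INTEGRAL IS BOUNDED UNIFORMLY IN `M² ≥ m²`**: `∫|propLine M²(x + ic)|dx ≤ 2π(1 + cosh c)∕(|c|(m² − c²))`. [folklore] -/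
theorem integral_norm_propLine_line_le (hM : 0 < M2) (hmM : m2 ≤ M2) (hc0 : c ≠ 0) (hc : c ^ 2 < m2) :
    ∫ x : ℝ, ‖propLine M2 ((x : ℂ) + c * I)‖ ≤ 2 * Real.pi * (1 + Real.cosh c) / (|c| * (m2 - c ^ 2)) := by
  have hg : Integrable fun x : ℝ => 2 * (1 + Real.cosh c) / (m2 - c ^ 2) * (c ^ 2)⁻¹ * (1 + (x / c) ^ 2)⁻¹ :=
    (integrable_inv_one_add_sq.comp_div hc0).const_mul _
  have hle : ∀ x : ℝ, ‖propLine M2 ((x : ℂ) + c * I)‖ ≤ 2 * (1 + Real.cosh c) / (m2 - c ^ 2) * (c ^ 2)⁻¹ * (1 + (x / c) ^ 2)⁻¹ := by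
    intro x
    refine (norm_propLine_line_le hmM hc0 hc x).trans (le_of_eq ?_)
    have hc2 : c ^ 2 ≠ 0 := pow_ne_zero 2 hc0
    have hmc : m2 - c ^ 2 ≠ 0 := by linarith
    field_simp
    ring
  calc ∫ x : ℝ, ‖propLine M2 ((x : ℂ) + c * I)‖
      ≤ ∫ x : ℝ, 2 * (1 + Real.cosh c) / (m2 - c ^ 2) * (c ^ 2)⁻¹ * (1 + (x / c) ^ 2)⁻¹ :=
        integral_mono (integrable_propLine_line hM hmM hc0 hc).norm hg hle
    _ = 2 * (1 + Real.cosh c) / (m2 - c ^ 2) * (c ^ 2)⁻¹ * (|c| * Real.pi) := by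
        rw [integral_const_mul, Measure.integral_comp_div (fun x : ℝ => (1 + x ^ 2)⁻¹) c, integral_univ_inv_one_add_sq,
          smul_eq_mul]
    _ = 2 * Real.pi * (1 + Real.cosh c) / (|c| * (m2 - c ^ 2)) := by
        have hc2 : c ^ 2 = |c| ^ 2 := (sq_abs c).symm
        have hca : |c| ≠ 0 := abs_ne_zero.mpr hc0
        have hmc : m2 - c ^ 2 ≠ 0 := by linarith
        rw [hc2]
        field_simp

end ShiftedLine

/-! ## §3 Uniform smallness as `|Re w| → ∞` in the strip `|Im w| < √m²` -/

section Vanishing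

variable {m2 M2 : ℝ}

/-- ★ In the strip `|Im w| < √m²` (`m² ≤ M²`), `propLine M² w → 0` uniformly as `|Re w| → ∞`. [folklore] -/
theorem propLine_uniformly_small (hmM : m2 ≤ M2) :
    ∀ ε > 0, ∃ R : ℝ, ∀ w : ℂ, |w.im| < Real.sqrt m2 → R ≤ |w.re| → ‖propLine M2 w‖ ≤ ε := by
  intro ε hε
  set A : ℝ := 2 * (1 + Real.cosh (Real.sqrt m2)) with hA
  have hA0 : 0 < A := by positivity
  refine ⟨max 1 (A / ε), fun w hwi hwr => ?_⟩
  have hR1 : 1 ≤ |w.re| := (le_max_left _ _).trans hwr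
  have hR2 : A / ε ≤ |w.re| := (le_max_right _ _).trans hwr
  have him2 : w.im ^ 2 < m2 := by
    have h := hwi
    rw [← Real.sqrt_sq_eq_abs, Real.sqrt_lt_sqrt_iff (sq_nonneg _)] at h
    exact h
  have hw0 : w ≠ 0 := by
    intro h; rw [h, zero_re, abs_zero] at hR1; linarith
  have hre2 : 1 ≤ w.re ^ 2 := by rw [← sq_abs]; nlinarith
  have hD : w.re ^ 2 ≤ w.re ^ 2 - w.im ^ 2 + M2 := by linarith
  have h1 := norm_propLine_le (M2 := M2) hw0 (by linarith)
  have hcosh : Real.cosh w.im ≤ Real.cosh (Real.sqrt m2) := by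
    rw [Real.cosh_le_cosh, abs_of_nonneg (Real.sqrt_nonneg _)]
    exact hwi.le
  have hnum : 2 * (1 + Real.cosh w.im) ≤ A := by rw [hA]; linarith
  have hnr : |w.re| ≤ ‖w‖ := Complex.abs_re_le_norm w
  have hn2 : w.re ^ 2 ≤ ‖w‖ ^ 2 := by rw [← sq_abs]; exact pow_le_pow_left₀ (abs_nonneg _) hnr 2
  have hden : A / ε ≤ ‖w‖ ^ 2 * (w.re ^ 2 - w.im ^ 2 + M2) := by
    have h3 : |w.re| ≤ |w.re| ^ 2 := by nlinarith
    have h4 : |w.re| ^ 2 = w.re ^ 2 := sq_abs _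
    calc A / ε ≤ |w.re| := hR2
      _ ≤ w.re ^ 2 := by rw [← h4]; exact h3
      _ ≤ ‖w‖ ^ 2 * 1 := by rw [mul_one]; exact hn2
      _ ≤ ‖w‖ ^ 2 * (w.re ^ 2 - w.im ^ 2 + M2) := mul_le_mul_of_nonneg_left (by linarith) (by positivity)
  have hdenpos : 0 < ‖w‖ ^ 2 * (w.re ^ 2 - w.im ^ 2 + M2) := lt_of_lt_of_le (by positivity) hden
  calc ‖propLine M2 w‖ ≤ 2 * (1 + Real.cosh w.im) / (‖w‖ ^ 2 * (w.re ^ 2 - w.im ^ 2 + M2)) := h1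
    _ ≤ A / (A / ε) := div_le_div₀ hA0.le hnum (by positivity) hden
    _ = ε := by field_simp

end Vanishing

end Summit.QuantumFields.YangMills.BalabanUVNodes.N15KingModelRung.OptimalDecay
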